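import Mathlib
import Summits.Ventures.HodgeRepro2.Tier7.Line3.CoverCountCompact

/-!
# Tier7/Line3/CoverCountGlobal — global `γ`: the unramified count `b_w(γ) = 1` at almost all places, and the split product
with constants at the adic model with the finite support of the counts DISCHARGED

Filer: t7-L1-p3 (gen 9, prover-pub-hodge-repro2-t7-L1-p3-g9-0), self-selected SUPPORT row (TARGET line with the 10-min
window). Lane: Line 3 SUPPORT, [M]-level; NOT a line, NOT a device; touches neither (a′) nor (b′).

WHAT IT SUPPLIES. CoverCountCompact's adic theorem `exists_splitFactor_le_of_compact_supports_adic` still DISPLAYS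
`hfin` — «the box at `γ` is non-empty at almost all places», the unramified computation `b_w(γ) = 1` for almost all `w`
(crit-2 l. 16214 (a), plan-3 l. 16217 (2)). For GLOBAL entries — `γ = !![a, b; c, d]` with `a, b, c, d ∈ K` read in every
`w.adicCompletion K` through `algebraMap`, the real situation — it is a THEOREM:
* H1 `mem_integralSubgroup_of_units`: a matrix with integral entries and unit determinant lies in `GL₂(O)` (its inverse
  `det⁻¹ · adjugate` has integral entries, `inv_entries_le_one`); `one_mem_sol`: if `γ ∈ U` the triple `(1, 1, 1)` solves
  `t⁻¹ γ s ∈ U`;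
* H2 `ncard_eq_one_of_units`: where `U = GL₂(O)`, the entries and the determinant are units, the count is EXACTLY `1` —
  `≤ 1` by the single-coset bound (`count_le_of_subset_integral` at `M₁ = M₂ = 0`, `ord 1 = 0`), `≥ 1` by the trivial
  solution and the finiteness of the value-pair set (`image_valuePair_sol_finite_of_subset`);
* H3 `finite_valuation_ne_one`: a non-zero `x ∈ K` is a unit at almost all finite places (`x = r/s`, `Ideal.finite_factors`);
  `finite_nonunit_places`: the places where an entry or the determinant of `γ` is not a unit form a finite set;
  `mulSupport_count_finite` — THE UNRAMIFIED COMPUTATION: for global entries and supports `U w = GL₂(O_w)` off a finite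
  set, the count is `1` at every place outside a finite set, so `hfin` holds;
* `exists_splitFactor_le_of_compact_supports_global`: CoverCountCompact's adic theorem with `hfin` DISCHARGED and `hS` in
  the natural form `{w | U w ≠ GL₂(O_w)}.Finite` — for compact supports `U w`, global entries `a b c d : Orb → K`
  (non-zero, `det ≠ 0`) and `he₁ : e₁ ≤ ord_w (I γ)`, `he₂ : e₂ ≤ ord_w (J γ)`, ONE constant `C` bounds `splitFactor b γ`
  by `C · (N(I γ) · N(J γ))^ε` for all `γ`, `b w γ := #(value pairs of sol (γ at w) (U w))`.

WHAT STAYS IN WORDS (the dictionary, (a′)) — the residue of the split-place table after this row: `U_w = supp f_w` is a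
compact subset of `GL₂(F_w)` with `U_w = GL₂(O_w)` off a finite set (the real `f_w = 1_{K_w}` off `S`); the real `γ` ARE
global (`U(W_A)(F)`) with the entries of the adapted basis non-zero (`κ(γ) ∉ {0, 1}`); `b w γ` IS this count; `e₁ ≤ ord_w
(I γ)`, `e₂ ≤ ord_w (J γ)` (displayed, the (h⁵⁗) dictionary inequality); the place datum. Nothing here is about (N), (P),
the real `X`, or HC_CM. §8(d): NO. Blind lane: Mathlib + the HodgeRepro2 prefix; no sorry;
axioms ⊆ {propext, Classical.choice, Quot.sound}.
-/

namespace Summit.Ventures.HodgeRepro2.Tier7.Line3.CoverCountGlobal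

open Matrix DoubleCoset WithZero Multiplicative Summit.Ventures.HodgeRepro2.Tier7.Line3.SplitOrbitBox
  Summit.Ventures.HodgeRepro2.Tier7.Line3.DoubleCosetCover
  Summit.Ventures.HodgeRepro2.Tier7.Line3.CosetEntryBounds
  Summit.Ventures.HodgeRepro2.Tier7.Line3.CoverCountLink
  Summit.Ventures.HodgeRepro2.Tier7.Line3.CoverCountCartan
  Summit.Ventures.HodgeRepro2.Tier7.Line3.CoverCountCompact

/-! ## H1. A matrix with unit-valued entries and unit determinant lies in `GL₂(O)`; the trivial solution -/

section Units

variable {F : Type*} [Field F] {Γ₀ : Type*} [LinearOrderedCommGroupWithZero Γ₀]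

/-- the entries of the inverse of a `2 × 2` matrix with unit-valued determinant and integral entries are integral. -/
theorem inv_entries_le_one (v : Valuation F Γ₀) (g : Matrix (Fin 2) (Fin 2) F) (hvdet : v g.det = 1)
    (hg : ∀ i j, v (g i j) ≤ 1) (i j : Fin 2) : v (g⁻¹ i j) ≤ 1 := by
  rw [Matrix.inv_def, Ring.inverse_eq_inv', Matrix.adjugate_fin_two, Matrix.smul_apply, smul_eq_mul,
    Valuation.map_mul, map_inv₀, hvdet, inv_one, one_mul]
  fin_cases i <;> fin_cases j <;> simp [hg]

/-- **a matrix with integral entries and unit determinant is in `GL₂(O)`** — the hypothesis is `v (det g) = 1` (a UNIT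
determinant: `v (det g) ≤ 1` would not do, e.g. `diag(ϖ, 1)` has integral entries and `v (det) < 1` but its inverse is not
integral); DoubleCosetCover's `integralSubgroup` asks the entries of `g` AND of `g⁻¹` in `O` (crit-2 l. 16270 (1)). -/
theorem mem_integralSubgroup_of_units (v : Valuation F Γ₀) (g : GL (Fin 2) F)
    (hg : ∀ i j, v ((g : Matrix (Fin 2) (Fin 2) F) i j) ≤ 1) (hvdet : v (g : Matrix (Fin 2) (Fin 2) F).det = 1) :
    g ∈ integralSubgroup v.integer := by
  refine (mem_integralSubgroup _ _).2 ⟨fun i j => (Valuation.mem_integer_iff v _).2 (hg i j), fun i j => ?_⟩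
  rw [Valuation.mem_integer_iff, Matrix.coe_units_inv]
  exact inv_entries_le_one v _ hvdet hg i j

/-- **the trivial solution**: if the matrix `γ` itself lies in `U`, the triple `(1, 1, 1)` solves `t⁻¹ γ s ∈ U`. -/
theorem one_mem_sol (a b c d : F) (U : Set (Matrix (Fin 2) (Fin 2) F)) (hγ : !![a, b; c, d] ∈ U) :
    ((1 : F), (1 : F), (1 : F)) ∈ sol a b c d U := by
  refine ⟨one_ne_zero, one_ne_zero, one_ne_zero, ?_⟩
  have h : conjMat a b c d ((1 : F), (1 : F), (1 : F)) = !![a, b; c, d] := by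
    ext i j
    fin_cases i <;> fin_cases j <;> simp [conjMat, diagonal, Matrix.mul_apply]
  rw [h]
  exact hγ

end Units

/-! ## H2. At a place where `U = GL₂(O)` and the entries and the determinant are units, the count is exactly `1` -/

section One

variable {F : Type*} [Field F]

/-- the value pairs of the solutions are finite when `U ⊆ K` (the single-coset cover; `a, b, c, d, det ≠ 0`). -/
theorem image_valuePair_sol_finite_of_subset (v : Valuation F (WithZero (Multiplicative ℤ)))
    {U : Set (GL (Fin 2) F)} (hUK : U ⊆ (integralSubgroup v.integer : Set (GL (Fin 2) F)))
    (a b c d : F) (ha : a ≠ 0) (hb : b ≠ 0) (hc : c ≠ 0) (hd : d ≠ 0) (hdet : a * d - b * c ≠ 0) :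
    (valuePair v '' sol a b c d
      ((fun x : GL (Fin 2) F => (x : Matrix (Fin 2) (Fin 2) F)) '' U)).Finite := by
  have hD : ∀ j ∈ (Finset.univ : Finset Unit), ∀ M ∈ (fun x : GL (Fin 2) F => (x : Matrix (Fin 2) (Fin 2) F)) ''
      doubleCoset (1 : GL (Fin 2) F) (integralSubgroup v.integer : Set (GL (Fin 2) F)) (integralSubgroup v.integer),
      (∀ i k, v (M i k) ≤ (fun _ : Unit => (1 : WithZero (Multiplicative ℤ))) j) ∧
        v M.det = (fun _ : Unit => (1 : WithZero (Multiplicative ℤ))) j := by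
    intro j _
    refine doubleCoset_image_bounds v (isIntegralSubgroup_integralSubgroup v) 1 1 1 ?_ ?_
    · intro i l
      rw [Units.val_one, Matrix.one_apply]
      split_ifs <;> simp
    · rw [Units.val_one, Matrix.det_one, Valuation.map_one]
  have hcov : (fun x : GL (Fin 2) F => (x : Matrix (Fin 2) (Fin 2) F)) '' U ⊆
      ⋃ j ∈ (Finset.univ : Finset Unit), (fun x : GL (Fin 2) F => (x : Matrix (Fin 2) (Fin 2) F)) ''
        doubleCoset (1 : GL (Fin 2) F) (integralSubgroup v.integer : Set (GL (Fin 2) F))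
          (integralSubgroup v.integer) := by
    rintro _ ⟨x, hx, rfl⟩
    refine Set.mem_iUnion₂.2 ⟨(), Finset.mem_univ _, x, ?_, rfl⟩
    exact mem_doubleCoset.2 ⟨x, hUK hx, 1, (integralSubgroup v.integer).one_mem, by simp⟩
  exact image_valuePair_sol_finite v a b c d ha hb hc hd hdet (Finset.univ : Finset Unit) _ _ _
    (fun _ => one_ne_zero) (fun _ => one_ne_zero) hD _ hcov

/-- `ord 1 = 0`. -/
theorem ord_one : ord (one_ne_zero : (1 : WithZero (Multiplicative ℤ)) ≠ 0) = 0 := by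
  have hu1 : unzero (one_ne_zero : (1 : WithZero (Multiplicative ℤ)) ≠ 0) = 1 := by
    rw [← WithZero.coe_inj, coe_unzero, WithZero.coe_one]
  unfold ord
  rw [hu1, toAdd_one]

/-- `ord` of a value equal to `1` is `0`. -/
theorem ord_eq_zero_of_eq_one {X : WithZero (Multiplicative ℤ)} (hX : X ≠ 0) (h : X = 1) : ord hX = 0 := by
  have : ord hX = ord (one_ne_zero : (1 : WithZero (Multiplicative ℤ)) ≠ 0) := by
    unfold ord; congr 1; simp_rw [h]
  rw [this, ord_one]

/-- **THE UNRAMIFIED COUNT IS `1`**: at a place where `U = GL₂(O)`, the entries and the determinant of `γ` are units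
(`v = 1`) and `ϖ` is a uniformiser, the number of value pairs of the solutions of `t⁻¹ γ s ∈ U` is EXACTLY `1`:
`≤ 1` is the single-coset bound `count_le_of_subset_integral` at `M₁ = M₂ = 0` (legitimate there because `e₁ = e₂ = 0`
when all five valuations are `1`, `ord_eq_zero_of_eq_one`); `≥ 1` needs the FINITENESS first (`Set.ncard` of an infinite
set is `0`) — `image_valuePair_sol_finite_of_subset` — then the trivial solution `(1, 1, 1)` (`one_mem_sol`, since `γ ∈ GL₂(O)`
by `mem_integralSubgroup_of_units`); the route is `Set.ncard_pos (hfin) : 0 < ncard ↔ Nonempty` + `omega`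
(`conjMat a b c d (1, 1, 1) = !![a, b; c, d]` is the entrywise computation inside `one_mem_sol`); plan-3 l. 16267 (1),
crit-2 l. 16270 (2). -/
theorem ncard_eq_one_of_units (v : Valuation F (WithZero (Multiplicative ℤ))) (ϖ : F)
    (hϖ : v ϖ = ((Multiplicative.ofAdd (-1 : ℤ) : Multiplicative ℤ) : WithZero (Multiplicative ℤ)))
    {U : Set (GL (Fin 2) F)} (hUK : U = (integralSubgroup v.integer : Set (GL (Fin 2) F)))
    (a b c d : F) (hva : v a = 1) (hvb : v b = 1) (hvc : v c = 1) (hvd : v d = 1)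
    (hvdet : v (a * d - b * c) = 1) :
    (valuePair v '' sol a b c d
      ((fun x : GL (Fin 2) F => (x : Matrix (Fin 2) (Fin 2) F)) '' U)).ncard = 1 := by
  have ha : a ≠ 0 := (Valuation.ne_zero_iff v).1 (by rw [hva]; exact one_ne_zero)
  have hb : b ≠ 0 := (Valuation.ne_zero_iff v).1 (by rw [hvb]; exact one_ne_zero)
  have hc : c ≠ 0 := (Valuation.ne_zero_iff v).1 (by rw [hvc]; exact one_ne_zero)
  have hd : d ≠ 0 := (Valuation.ne_zero_iff v).1 (by rw [hvd]; exact one_ne_zero)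
  have hdet : a * d - b * c ≠ 0 := (Valuation.ne_zero_iff v).1 (by rw [hvdet]; exact one_ne_zero)
  have hfin := image_valuePair_sol_finite_of_subset v hUK.le a b c d ha hb hc hd hdet
  -- the upper bound: `≤ 1` with `M₁ = M₂ = 0`
  have he₁ : ord ((Valuation.ne_zero_iff v).2 hdet) - ord ((Valuation.ne_zero_iff v).2 ha) -
      ord ((Valuation.ne_zero_iff v).2 hd) ≤ ((0 : ℕ) : ℤ) := by
    rw [ord_eq_zero_of_eq_one _ hvdet, ord_eq_zero_of_eq_one _ hva, ord_eq_zero_of_eq_one _ hvd]; simp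
  have he₂ : ord ((Valuation.ne_zero_iff v).2 hdet) - ord ((Valuation.ne_zero_iff v).2 hb) -
      ord ((Valuation.ne_zero_iff v).2 hc) ≤ ((0 : ℕ) : ℤ) := by
    rw [ord_eq_zero_of_eq_one _ hvdet, ord_eq_zero_of_eq_one _ hvb, ord_eq_zero_of_eq_one _ hvc]; simp
  have hle := count_le_of_subset_integral v ϖ hϖ hUK.le a b c d ha hb hc hd hdet 0 0 he₁ he₂
  simp only [Nat.cast_zero, add_zero, mul_one] at hle
  have hle' : (valuePair v '' sol a b c d
      ((fun x : GL (Fin 2) F => (x : Matrix (Fin 2) (Fin 2) F)) '' U)).ncard ≤ 1 := by exact_mod_cast hle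
  -- the lower bound: the trivial solution, since `γ ∈ GL₂(O)`
  have hγdet : (!![a, b; c, d] : Matrix (Fin 2) (Fin 2) F).det ≠ 0 := by
    rw [Matrix.det_fin_two_of]; exact hdet
  have hunit : IsUnit (!![a, b; c, d] : Matrix (Fin 2) (Fin 2) F).det := isUnit_iff_ne_zero.2 hγdet
  let g : GL (Fin 2) F := ⟨!![a, b; c, d], (!![a, b; c, d] : Matrix (Fin 2) (Fin 2) F)⁻¹,
    Matrix.mul_nonsing_inv _ hunit, Matrix.nonsing_inv_mul _ hunit⟩
  have hgK : g ∈ integralSubgroup v.integer := by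
    refine mem_integralSubgroup_of_units v g (fun i j => ?_) ?_
    · show v ((!![a, b; c, d] : Matrix (Fin 2) (Fin 2) F) i j) ≤ 1
      fin_cases i <;> fin_cases j <;> simp [hva, hvb, hvc, hvd]
    · show v (!![a, b; c, d] : Matrix (Fin 2) (Fin 2) F).det = 1
      rw [Matrix.det_fin_two_of]; exact hvdet
  have hγU : (!![a, b; c, d] : Matrix (Fin 2) (Fin 2) F) ∈
      (fun x : GL (Fin 2) F => (x : Matrix (Fin 2) (Fin 2) F)) '' U :=
    ⟨g, by rw [hUK]; exact hgK, rfl⟩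
  have hne : (valuePair v '' sol a b c d
      ((fun x : GL (Fin 2) F => (x : Matrix (Fin 2) (Fin 2) F)) '' U)).Nonempty :=
    ⟨_, ⟨_, one_mem_sol a b c d _ hγU, rfl⟩⟩
  have hpos := (Set.ncard_pos hfin).2 hne
  omega

end One

/-! ## H3. Global entries: units at almost all places (`Ideal.finite_factors`) -/

section Global

open IsDedekindDomain IsDedekindDomain.HeightOneSpectrum NumberField Function
  Summit.Ventures.HodgeRepro2.Tier7.Line3.SplitFactorProduct
open scoped NumberField

variable {K : Type*} [Field K] [NumberField K]

/-- **a non-zero element of a number field is a unit at almost all finite places**: the set of `w` with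
`w.valuation K x ≠ 1` is finite (write `x = r / s` with `r, s ∈ 𝓞 K` non-zero; `w.valuation K x ≠ 1` forces `r ∈ w` or
`s ∈ w`, i.e. `w ∣ (r)` or `w ∣ (s)`, finitely many by `Ideal.finite_factors`). -/
theorem finite_valuation_ne_one {x : K} (hx : x ≠ 0) :
    {w : HeightOneSpectrum (𝓞 K) | w.valuation K x ≠ 1}.Finite := by
  obtain ⟨r, s, hs, hrs⟩ := IsFractionRing.div_surjective (A := 𝓞 K) x
  have hs0 : s ≠ 0 := nonZeroDivisors.ne_zero hs
  have hr0 : r ≠ 0 := by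
    rintro rfl
    apply hx
    rw [← hrs, map_zero, zero_div]
  have hsub : {w : HeightOneSpectrum (𝓞 K) | w.valuation K x ≠ 1} ⊆
      {w : HeightOneSpectrum (𝓞 K) | w.asIdeal ∣ Ideal.span {r}} ∪
        {w : HeightOneSpectrum (𝓞 K) | w.asIdeal ∣ Ideal.span {s}} := by
    intro w hw
    simp only [Set.mem_setOf_eq] at hw
    by_contra hcon
    simp only [Set.mem_union, Set.mem_setOf_eq, not_or, Ideal.dvd_span_singleton] at hcon
    apply hw
    rw [← hrs, Valuation.map_div, valuation_of_algebraMap, valuation_of_algebraMap,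
      intValuation_eq_one_iff.2 hcon.1, intValuation_eq_one_iff.2 hcon.2, div_one]
  have hr' : Ideal.span {r} ≠ 0 := by
    rw [Ne, Submodule.zero_eq_bot, Ideal.span_singleton_eq_bot]; exact hr0
  have hs' : Ideal.span {s} ≠ 0 := by
    rw [Ne, Submodule.zero_eq_bot, Ideal.span_singleton_eq_bot]; exact hs0
  exact ((Ideal.finite_factors hr').union (Ideal.finite_factors hs')).subset hsub

/-- the valuation of the completion on the image of `K`: `Valued.v (algebraMap K (w.adicCompletion K) x) = w.valuation K x`
— Mathlib's `IsDedekindDomain.HeightOneSpectrum.adicCompletion.valued_coe` (= `valuedAdicCompletion_eq_valuation'`), read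
through `algebraMap K (w.adicCompletion K) = (↑)` (definitional); plan-3 l. 16267 (2). -/
theorem valued_algebraMap (w : HeightOneSpectrum (𝓞 K)) (x : K) :
    (Valued.v (algebraMap K (w.adicCompletion K) x) : WithZero (Multiplicative ℤ)) = w.valuation K x :=
  adicCompletion.valued_coe K w x

/-- **the exceptional places of a global `γ`**: where an entry or the determinant is not a unit — a finite set. -/
theorem finite_nonunit_places (a b c d : K) (ha : a ≠ 0) (hb : b ≠ 0) (hc : c ≠ 0) (hd : d ≠ 0)
    (hdet : a * d - b * c ≠ 0) :
    {w : HeightOneSpectrum (𝓞 K) | ¬ (w.valuation K a = 1 ∧ w.valuation K b = 1 ∧ w.valuation K c = 1 ∧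
      w.valuation K d = 1 ∧ w.valuation K (a * d - b * c) = 1)}.Finite := by
  refine ((((finite_valuation_ne_one ha).union (finite_valuation_ne_one hb)).union
    (finite_valuation_ne_one hc)).union ((finite_valuation_ne_one hd).union
      (finite_valuation_ne_one hdet))).subset fun w hw => ?_
  simp only [Set.mem_setOf_eq, Set.mem_union] at hw ⊢
  tauto

/-- **THE UNRAMIFIED COMPUTATION `b_w(γ) = 1` AT ALMOST ALL PLACES** (the displayed `hfin` of CoverCountCompact as a
theorem for GLOBAL entries): for `γ = !![a, b; c, d]` with entries in `K` (non-zero, `det ≠ 0`) read in every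
`w.adicCompletion K` — the per-place entries `algebraMap K (w.adicCompletion K) a`, … are the images of ONE global matrix,
never five independent local data (plan-3 l. 16267 (3)) — and supports `U w` equal to `GL₂(O_w)` off a finite set, the
count of value pairs is `1` at every place outside the finite set `S ∪ {w | an entry or the determinant is not a unit}`
(`ncard_eq_one_of_units` there; `finite_nonunit_places`), so `(1 : ℝ)` is off the multiplicative support, which is
therefore finite. -/
theorem mulSupport_count_finite (U : ∀ w : HeightOneSpectrum (𝓞 K), Set (GL (Fin 2) (w.adicCompletion K)))
    (hS : {w : HeightOneSpectrum (𝓞 K) | U w ≠ (integralSubgroup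
      (Valued.v : Valuation (w.adicCompletion K) (WithZero (Multiplicative ℤ))).integer :
      Set (GL (Fin 2) (w.adicCompletion K)))}.Finite)
    (a b c d : K) (ha : a ≠ 0) (hb : b ≠ 0) (hc : c ≠ 0) (hd : d ≠ 0) (hdet : a * d - b * c ≠ 0) :
    (mulSupport fun w : HeightOneSpectrum (𝓞 K) =>
      ((valuePair (Valued.v : Valuation (w.adicCompletion K) (WithZero (Multiplicative ℤ))) ''
        sol (algebraMap K (w.adicCompletion K) a) (algebraMap K (w.adicCompletion K) b)
          (algebraMap K (w.adicCompletion K) c) (algebraMap K (w.adicCompletion K) d)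
        ((fun x : GL (Fin 2) (w.adicCompletion K) => (x : Matrix (Fin 2) (Fin 2) (w.adicCompletion K))) ''
          U w)).ncard : ℝ)).Finite := by
  refine (hS.union (finite_nonunit_places a b c d ha hb hc hd hdet)).subset fun w hw => ?_
  simp only [Set.mem_union, Set.mem_setOf_eq]
  by_contra hcon
  simp only [ne_eq, not_or, not_not] at hcon
  obtain ⟨hUw, hva, hvb, hvc, hvd, hvdet⟩ := hcon
  apply hw
  obtain ⟨ϖ, hϖ⟩ := exists_uniformizer_adicCompletion w
  have h1 := ncard_eq_one_of_units (Valued.v : Valuation (w.adicCompletion K) (WithZero (Multiplicative ℤ))) ϖ hϖ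
    hUw (algebraMap K (w.adicCompletion K) a) (algebraMap K (w.adicCompletion K) b)
    (algebraMap K (w.adicCompletion K) c) (algebraMap K (w.adicCompletion K) d)
    (by rw [valued_algebraMap, hva]) (by rw [valued_algebraMap, hvb]) (by rw [valued_algebraMap, hvc])
    (by rw [valued_algebraMap, hvd]) (by rw [← map_mul, ← map_mul, ← map_sub, valued_algebraMap, hvdet])
  simp only [h1, Nat.cast_one]

/-- **THE SPLIT PRODUCT WITH CONSTANTS FOR GLOBAL `γ` AT THE ADIC MODEL** — CoverCountCompact's
`exists_splitFactor_le_of_compact_supports_adic` with `hfin` DISCHARGED (`mulSupport_count_finite`) and `hS` in its natural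
form `U w = GL₂(O_w)` off a finite set: for `I, J`, compact supports `U w` with `hS`, and entries `a b c d : Orb → K`
(non-zero, `det ≠ 0`) with `he₁ : e₁ ≤ ord_w (I γ)`, `he₂ : e₂ ≤ ord_w (J γ)` (the exponents read at the completion
valuation = `w.valuation K` on `K`), ONE constant `C` bounds `splitFactor b γ` by `C · (N(I γ) · N(J γ))^ε` for all `γ`,
`b w γ := #(value pairs of sol (γ at w) (U w))`. What is displayed: `U w` compact, `hS`, the non-vanishing of the
entries, `he₁ / he₂`; what is not: any cover, Cartan datum, per-coset clause, uniformiser, topology or finiteness of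
the counts. The natural `hS` («`U_w = GL₂(O_w)` off a finite set» — the dictionary's `f_w = 1_{K_w}` off `S`) is STRONGER
than the `_adic` theorem's `{w | ¬ U w ⊆ K_w}.Finite` and implies it; `_adic` (p716798) is untouched, this theorem
composes it with `mulSupport_count_finite` (plan-3 l. 16267 (4)). -/
theorem exists_splitFactor_le_of_compact_supports_global {Orb : Type*} (I J : Orb → Ideal (𝓞 K)) {ε : ℝ}
    (hε : 0 < ε) (hI : ∀ γ, I γ ≠ ⊥) (hJ : ∀ γ, J γ ≠ ⊥)
    (U : ∀ w : HeightOneSpectrum (𝓞 K), Set (GL (Fin 2) (w.adicCompletion K))) (hU : ∀ w, IsCompact (U w))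
    (hS : {w : HeightOneSpectrum (𝓞 K) | U w ≠ (integralSubgroup
      (Valued.v : Valuation (w.adicCompletion K) (WithZero (Multiplicative ℤ))).integer :
      Set (GL (Fin 2) (w.adicCompletion K)))}.Finite)
    (a b c d : Orb → K)
    (ha : ∀ γ, a γ ≠ 0) (hb : ∀ γ, b γ ≠ 0) (hc : ∀ γ, c γ ≠ 0) (hd : ∀ γ, d γ ≠ 0)
    (hdet : ∀ γ, a γ * d γ - b γ * c γ ≠ 0)
    (he₁ : ∀ (w : HeightOneSpectrum (𝓞 K)) γ,
      ord ((Valuation.ne_zero_iff (Valued.v : Valuation (w.adicCompletion K) (WithZero (Multiplicative ℤ)))).2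
          (show algebraMap K (w.adicCompletion K) (a γ) * algebraMap K (w.adicCompletion K) (d γ) -
            algebraMap K (w.adicCompletion K) (b γ) * algebraMap K (w.adicCompletion K) (c γ) ≠ 0 by
              rw [← map_mul, ← map_mul, ← map_sub]; exact (map_ne_zero _).2 (hdet γ))) -
        ord ((Valuation.ne_zero_iff (Valued.v : Valuation (w.adicCompletion K) (WithZero (Multiplicative ℤ)))).2
          ((map_ne_zero (algebraMap K (w.adicCompletion K))).2 (ha γ))) -
        ord ((Valuation.ne_zero_iff (Valued.v : Valuation (w.adicCompletion K) (WithZero (Multiplicative ℤ)))).2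
          ((map_ne_zero (algebraMap K (w.adicCompletion K))).2 (hd γ))) ≤ (multiplicity w.asIdeal (I γ) : ℤ))
    (he₂ : ∀ (w : HeightOneSpectrum (𝓞 K)) γ,
      ord ((Valuation.ne_zero_iff (Valued.v : Valuation (w.adicCompletion K) (WithZero (Multiplicative ℤ)))).2
          (show algebraMap K (w.adicCompletion K) (a γ) * algebraMap K (w.adicCompletion K) (d γ) -
            algebraMap K (w.adicCompletion K) (b γ) * algebraMap K (w.adicCompletion K) (c γ) ≠ 0 by
              rw [← map_mul, ← map_mul, ← map_sub]; exact (map_ne_zero _).2 (hdet γ))) -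
        ord ((Valuation.ne_zero_iff (Valued.v : Valuation (w.adicCompletion K) (WithZero (Multiplicative ℤ)))).2
          ((map_ne_zero (algebraMap K (w.adicCompletion K))).2 (hb γ))) -
        ord ((Valuation.ne_zero_iff (Valued.v : Valuation (w.adicCompletion K) (WithZero (Multiplicative ℤ)))).2
          ((map_ne_zero (algebraMap K (w.adicCompletion K))).2 (hc γ))) ≤ (multiplicity w.asIdeal (J γ) : ℤ)) :
    ∃ C : ℝ, 0 < C ∧ ∀ γ,
      splitFactor (fun (w : HeightOneSpectrum (𝓞 K)) γ =>
        (valuePair (Valued.v : Valuation (w.adicCompletion K) (WithZero (Multiplicative ℤ))) ''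
          sol (algebraMap K (w.adicCompletion K) (a γ)) (algebraMap K (w.adicCompletion K) (b γ))
            (algebraMap K (w.adicCompletion K) (c γ)) (algebraMap K (w.adicCompletion K) (d γ))
          ((fun x : GL (Fin 2) (w.adicCompletion K) => (x : Matrix (Fin 2) (Fin 2) (w.adicCompletion K))) ''
            U w)).ncard) γ ≤
        C * ((Ideal.absNorm (I γ) : ℝ) * Ideal.absNorm (J γ)) ^ ε :=
  exists_splitFactor_le_of_compact_supports_adic I J hε hI hJ U hU
    (hS.subset fun w hw => by
      simp only [Set.mem_setOf_eq] at hw ⊢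
      intro h; exact hw h.le)
    (fun w γ => algebraMap K (w.adicCompletion K) (a γ)) (fun w γ => algebraMap K (w.adicCompletion K) (b γ))
    (fun w γ => algebraMap K (w.adicCompletion K) (c γ)) (fun w γ => algebraMap K (w.adicCompletion K) (d γ))
    (fun w γ => (map_ne_zero _).2 (ha γ)) (fun w γ => (map_ne_zero _).2 (hb γ))
    (fun w γ => (map_ne_zero _).2 (hc γ)) (fun w γ => (map_ne_zero _).2 (hd γ))
    (fun w γ => by rw [← map_mul, ← map_mul, ← map_sub]; exact (map_ne_zero _).2 (hdet γ))
    he₁ he₂ (fun γ => mulSupport_count_finite U hS (a γ) (b γ) (c γ) (d γ) (ha γ) (hb γ) (hc γ) (hd γ) (hdet γ))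

end Global

end Summit.Ventures.HodgeRepro2.Tier7.Line3.CoverCountGlobal
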